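import Summits.FinalStateConjecture.FinalStateConjecture.Theorems.EIHFluxBalanceInertialRecessionStubEndgameBasics

/-!
# Route EIHFluxBalance — crux `InertialRecession`, line `sublinear-is-free-clean-window-charges`:
# velocity limits ⇒ the pairwise dichotomy, and the combinatorial "empty band" of the general-N roadmap

Helper file for the crux `stmt-FinalStateConjecture-10166`
(`Summit.FinalStateConjecture.FinalStateConjecture.Theses.EIHFluxBalance.InertialRecession`), registered stub
`stub_pairwiseDichotomy` (lead reshape r7) of `Cruxes/InertialRecession/Lines/sublinear_is_free_clean_window_charges.lean`.

Two bricks of the general-`N` roadmap (`Endgame_generalN_roadmap.md`, evidence on the item):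

* `dichotomy_of_tendsto_velocity`: if every velocity `vₖ` converges, then every pair of centres either separates linearly or locks
  velocities — so the registered PAIRWISE DICHOTOMY (hence Cesàro velocities, `…StubEndgameClasses`) follows from the convergence of
  the velocities, which is what the roadmap proves.
* `exists_emptyBand` / `equivalence_of_emptyBand`: among finitely many nonnegative "pair speeds" one of the geometric bands
  `[θ/Q^{j+1}, θ/Q^j)`, `j ≤ #speeds`, is empty (pigeonhole); and when the band `[θ′, Qθ′)` with `Q ≥ 2` contains no value of a
  symmetric, triangle-type speed function `w`, the relation `w k l < θ′` is an equivalence relation (two slow steps give `< 2θ′ ≤ Qθ′`,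
  hence `< θ′`). This is the velocity-space clustering with a `Q`-gap that separates the "wobble" of slow classes from the ballistic
  tolerance of fast pairs.

References: D. Saari, Trans. AMS 156 (1971) 219–240; C. Marchal, D. Saari, J. Differential Equations 20 (1976) 150–186;
J. Dereziński, C. Gérard, Scattering theory of classical and quantum N-particle systems (Springer 1997), Ch. 5.
-/

noncomputable section

set_option linter.dupNamespace false

open Filter Topology Set

namespace Summit.FinalStateConjecture.FinalStateConjecture.Theorems.SublinearIsFree.Endgame

open Literature.Geometry.Lorentzian

/-! ### Velocity limits ⇒ pairwise dichotomy -/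

/-- If the slaved velocities of two centres converge to DIFFERENT limits, the centres separate linearly. [folklore] -/
theorem linear_separation_of_tendsto_velocity {ξ₁ ξ₂ v₁ v₂ : ℝ → E3} {V₁ V₂ : E3}
    (h₁ : Differentiable ℝ ξ₁) (h₂ : Differentiable ℝ ξ₂)
    (hs₁ : Tendsto (fun t ↦ deriv ξ₁ t - v₁ t) atTop (𝓝 0)) (hs₂ : Tendsto (fun t ↦ deriv ξ₂ t - v₂ t) atTop (𝓝 0))
    (hv₁ : Tendsto v₁ atTop (𝓝 V₁)) (hv₂ : Tendsto v₂ atTop (𝓝 V₂)) (hne : V₁ ≠ V₂) :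
    ∃ σ : ℝ, 0 < σ ∧ ∀ᶠ t in atTop, σ * t ≤ ‖ξ₂ t - ξ₁ t‖ := by
  have hc₁ := tendsto_inv_smul_of_slaved h₁ hs₁ hv₁
  have hc₂ := tendsto_inv_smul_of_slaved h₂ hs₂ hv₂
  have hc : Tendsto (fun t : ℝ ↦ t⁻¹ • (ξ₂ t - ξ₁ t)) atTop (𝓝 (V₂ - V₁)) := by
    simpa [smul_sub] using hc₂.sub hc₁
  have hpos : 0 < ‖V₂ - V₁‖ := norm_pos_iff.mpr (sub_ne_zero.mpr hne.symm)
  refine ⟨‖V₂ - V₁‖ / 2, half_pos hpos, ?_⟩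
  have hn : Tendsto (fun t : ℝ ↦ ‖t⁻¹ • (ξ₂ t - ξ₁ t)‖) atTop (𝓝 ‖V₂ - V₁‖) := hc.norm
  have hev : ∀ᶠ t : ℝ in atTop, ‖V₂ - V₁‖ / 2 < ‖t⁻¹ • (ξ₂ t - ξ₁ t)‖ :=
    hn.eventually (lt_mem_nhds (by linarith))
  filter_upwards [hev, eventually_gt_atTop 0] with t ht ht0
  rw [norm_smul, norm_inv, Real.norm_eq_abs, abs_of_pos ht0] at ht
  have := (lt_inv_mul_iff₀ ht0).mp ht
  linarith

/-- **VELOCITY LIMITS ⇒ PAIRWISE DICHOTOMY.** If every (slaved) velocity converges, then every pair of centres either separates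
linearly or locks velocities. [folklore] -/
theorem dichotomy_of_tendsto_velocity (N : ℕ) (ξ v : Fin N → ℝ → E3)
    (hsmooth : ∀ i, ContDiff ℝ ((⊤ : ℕ∞) : WithTop ℕ∞) (ξ i))
    (hslave : ∀ i, Tendsto (fun t ↦ deriv (ξ i) t - v i t) atTop (𝓝 0))
    (hlim : ∀ i, ∃ V : E3, Tendsto (v i) atTop (𝓝 V)) (i j : Fin N) :
    (∃ σ : ℝ, 0 < σ ∧ ∀ᶠ t in atTop, σ * t ≤ ‖ξ j t - ξ i t‖) ∨
      Tendsto (fun t ↦ v j t - v i t) atTop (𝓝 0) := by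
  obtain ⟨Vi, hVi⟩ := hlim i
  obtain ⟨Vj, hVj⟩ := hlim j
  by_cases h : Vi = Vj
  · right
    subst h
    simpa using hVj.sub hVi
  · left
    have hd : ∀ k, Differentiable ℝ (ξ k) := fun k ↦ (hsmooth k).differentiable (by simp)
    exact linear_separation_of_tendsto_velocity (hd i) (hd j) (hslave i) (hslave j) hVi hVj h

/-! ### The empty band (pigeonhole) and the induced velocity classes -/

/-- **EMPTY BAND.** For a finite set `s` of reals and `θ > 0`, `Q > 1`, one of the `#s + 1` bands `[θ/Q^{j+1}, θ/Q^j)`,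
`j ≤ #s`, contains no element of `s`. [folklore] -/
theorem exists_emptyBand (s : Finset ℝ) {θ Q : ℝ} (hθ : 0 < θ) (hQ : 1 < Q) :
    ∃ j : ℕ, j ≤ s.card ∧ ∀ x ∈ s, ¬ (θ / Q ^ (j + 1) ≤ x ∧ x < θ / Q ^ j) := by
  classical
  by_contra hcon
  push Not at hcon
  -- every band `j ≤ #s` is inhabited by some element of `s`
  choose f hf using fun j : Fin (s.card + 1) ↦ hcon j (Nat.lt_succ_iff.mp j.2)
  -- the chosen elements are pairwise distinct: the bands are disjoint
  have hQ0 : 0 < Q := zero_lt_one.trans hQ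
  have hanti : ∀ {a b : ℕ}, a < b → θ / Q ^ b ≤ θ / Q ^ (a + 1) := fun {a b} hab ↦ by
    refine div_le_div_of_nonneg_left hθ.le (pow_pos hQ0 _) ?_
    exact pow_le_pow_right₀ hQ.le hab
  have hinj : Function.Injective f := by
    intro a b hab
    by_contra hne
    rcases lt_or_gt_of_ne (Fin.val_injective.ne hne) with hlt | hlt
    · have h3 : θ / Q ^ ((a : ℕ) + 1) ≤ f a := (hf a).2.1
      have h4 : f b < θ / Q ^ (b : ℕ) := (hf b).2.2
      rw [hab] at h3
      exact absurd (h3.trans_lt h4) (not_lt.mpr (hanti hlt))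
    · have h3 : θ / Q ^ ((b : ℕ) + 1) ≤ f b := (hf b).2.1
      have h4 : f a < θ / Q ^ (a : ℕ) := (hf a).2.2
      rw [← hab] at h3
      exact absurd (h3.trans_lt h4) (not_lt.mpr (hanti hlt))
  have hmem : ∀ j, f j ∈ s := fun j ↦ (hf j).1
  have hcard : s.card + 1 ≤ s.card := by
    calc s.card + 1 = (Finset.univ : Finset (Fin (s.card + 1))).card := by simp
      _ = (Finset.univ.image f).card := (Finset.card_image_of_injective _ hinj).symm
      _ ≤ s.card := Finset.card_le_card (by
          intro x hx
          obtain ⟨j, -, rfl⟩ := Finset.mem_image.mp hx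
          exact hmem j)
  omega

/-- **VELOCITY CLASSES.** If a symmetric "speed" function `w` on a type satisfies the triangle inequality and vanishes on the
diagonal, and NO value of `w` lies in the band `[θ′, Qθ′)` with `Q ≥ 2`, then `w k l < θ′` is an equivalence relation: two slow
steps give speed `< 2θ′ ≤ Qθ′`, which the empty band forces below `θ′`. [folklore] -/
theorem equivalence_of_emptyBand {ι : Type*} (w : ι → ι → ℝ) {θ' Q : ℝ} (hQ : 2 ≤ Q) (hθ : 0 < θ')
    (hdiag : ∀ k, w k k = 0) (hsymm : ∀ k l, w k l = w l k) (htri : ∀ k l m, w k m ≤ w k l + w l m)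
    (hband : ∀ k l, ¬ (θ' ≤ w k l ∧ w k l < Q * θ')) :
    Equivalence fun k l ↦ w k l < θ' := by
  refine ⟨fun k ↦ by rw [hdiag]; exact hθ, fun {k l} h ↦ by rwa [hsymm], fun {k l m} hkl hlm ↦ ?_⟩
  have h2 : w k m < Q * θ' := by
    have := htri k l m
    nlinarith
  by_contra hge
  exact hband k m ⟨not_lt.mp hge, h2⟩

/-- The speed function of a velocity configuration, `w k l = ‖u k − u l‖`, is symmetric, vanishes on the diagonal and satisfies
the triangle inequality; so an empty band makes "slow" an equivalence relation (`equivalence_of_emptyBand`). [folklore] -/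
theorem equivalence_slow_of_emptyBand {ι : Type*} (u : ι → E3) {θ' Q : ℝ} (hQ : 2 ≤ Q) (hθ : 0 < θ')
    (hband : ∀ k l, ¬ (θ' ≤ ‖u k - u l‖ ∧ ‖u k - u l‖ < Q * θ')) :
    Equivalence fun k l ↦ ‖u k - u l‖ < θ' :=
  equivalence_of_emptyBand (fun k l ↦ ‖u k - u l‖) hQ hθ (fun k ↦ by simp) (fun k l ↦ norm_sub_rev _ _)
    (fun k l m ↦ norm_sub_le_norm_sub_add_norm_sub _ _ _) hband

/-- **THE Q-GAP AT A GIVEN TIME.** For `N` velocities `u k` and `θ > 0`, `Q ≥ 2`, there is a threshold `θ′ = θ/Q^{j+1}` with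
`j ≤ N²` such that no pair speed lies in `[θ′, Qθ′)`; consequently "‖u k − u l‖ < θ′" partitions the indices into classes with
internal speeds `< θ′` and cross speeds `≥ Qθ′`. [folklore] -/
theorem exists_gap_threshold {N : ℕ} (u : Fin N → E3) {θ Q : ℝ} (hθ : 0 < θ) (hQ : 2 ≤ Q) :
    ∃ θ' : ℝ, θ / Q ^ (N * N + 1) ≤ θ' ∧ θ' ≤ θ / Q ∧ 0 < θ' ∧
      (∀ k l, ‖u k - u l‖ < θ' ∨ Q * θ' ≤ ‖u k - u l‖) ∧
      Equivalence fun k l ↦ ‖u k - u l‖ < θ' := by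
  classical
  have hQ1 : 1 < Q := by linarith
  have hQ0 : 0 < Q := by linarith
  set s : Finset ℝ := (Finset.univ : Finset (Fin N × Fin N)).image fun p ↦ ‖u p.1 - u p.2‖ with hs
  obtain ⟨j, hj, hfree⟩ := exists_emptyBand s hθ hQ1
  have hcard : s.card ≤ N * N := by
    calc s.card ≤ (Finset.univ : Finset (Fin N × Fin N)).card := Finset.card_image_le
      _ = N * N := by simp
  have hband : ∀ k l, ¬ (θ / Q ^ (j + 1) ≤ ‖u k - u l‖ ∧ ‖u k - u l‖ < Q * (θ / Q ^ (j + 1))) := by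
    intro k l h
    have hmem : ‖u k - u l‖ ∈ s := Finset.mem_image.mpr ⟨(k, l), Finset.mem_univ _, rfl⟩
    refine hfree _ hmem ⟨h.1, ?_⟩
    have : Q * (θ / Q ^ (j + 1)) = θ / Q ^ j := by
      rw [pow_succ]; field_simp
    rw [← this]; exact h.2
  refine ⟨θ / Q ^ (j + 1), ?_, ?_, by positivity, ?_, ?_⟩
  · refine div_le_div_of_nonneg_left hθ.le (pow_pos hQ0 _) ?_
    exact pow_le_pow_right₀ hQ1.le (by omega)
  · refine div_le_div_of_nonneg_left hθ.le hQ0 ?_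
    calc Q = Q ^ 1 := (pow_one Q).symm
      _ ≤ Q ^ (j + 1) := pow_le_pow_right₀ hQ1.le (by omega)
  · intro k l
    by_contra hh
    push Not at hh
    exact hband k l ⟨hh.1, hh.2⟩
  · exact equivalence_slow_of_emptyBand u hQ (by positivity) hband

/-- Registered helper form of `dichotomy_of_tendsto_velocity` (velocity limits ⇒ the pairwise dichotomy). [folklore] -/
theorem endgame_dichotomy_of_tendsto_velocity : open Literature.Geometry.Lorentzian Filter Topology in ∀ (N : ℕ) (ξ v : Fin N → ℝ → E3), (∀ i, ContDiff ℝ ((⊤ : ℕ∞) : WithTop ℕ∞) (ξ i)) → (∀ i, Tendsto (fun t ↦ deriv (ξ i) t - v i t) atTop (𝓝 0)) → (∀ i, ∃ V : E3, Tendsto (v i) atTop (𝓝 V)) → ∀ i j : Fin N, (∃ σ : ℝ, 0 < σ ∧ ∀ᶠ t in atTop, σ * t ≤ ‖ξ j t - ξ i t‖) ∨ Tendsto (fun t ↦ v j t - v i t) atTop (𝓝 0) :=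
  fun N ξ v hsmooth hslave hlim i j ↦ dichotomy_of_tendsto_velocity N ξ v hsmooth hslave hlim i j

end Summit.FinalStateConjecture.FinalStateConjecture.Theorems.SublinearIsFree.Endgame

end
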